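import Summits.HodgeConjecture.HodgeConjecture.Theorems.Q8SymplecticPowersTransportHeredityOffNullMeagre
import Summits.HodgeConjecture.HodgeConjecture.Theorems.Q8SymplecticPowersK1QOfStubsKollarFree
import Summits.HodgeConjecture.HodgeConjecture.Theorems.Q8SymplecticPowersRegularOfDesingularization
import Summits.HodgeConjecture.HodgeConjecture.Theorems.Q8SymplecticPowersRegularOfOneFibre
import HarnessLib

/-!
# K1Q WITHOUT Cattani–Deligne–Kaplan, composed: the crux body OFF A MEAGRE CHART-NULL SET of members, pointwise in `e`,
# from (Z_b) AT `e`, the S9-package AT `e` (for `e = 4`: the registered LCERT₄) and Deligne 1987 ONLY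

Route `HodgeConjecture/Q8SymplecticPowers`, crux K1Q `VeryGeneralQuaternionCommutatorsInHg` (stmt-HodgeConjecture-24190). Helper
(`--supports stmt-HodgeConjecture-24190 --as helper`; nothing here closes an item; no definition; ONE print input, Deligne 1987 Prop. 1.13).

`Q8SymplecticPowersTransportHeredityOffNullMeagre.transportHeredity_offNullMeagre_at` (this seat) is the S7⁺⁺ telescope with the CDK cover
replaced by the tree's unconditional `exists_nullMeagre_isHodgeGenericPoint`. This file composes it with the regularity input in its weakest
landed currency (Z_b) — along the package's OWN family `b₁` is constant (`W(ℂ)` path connected, Ehresmann), so ONE Betti-regular member in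
the dense image of `W(ℂ)` makes every member regular — and with the member-certificate closers of v14 (p731940 → p733014 → p730189-minus-Kollár):

* `K1Q_offNullMeagre_at` — Deligne87 → for every even `e ≥ 4`: (Z_b) at `e` → the S9-`∃`-package at `e` → **the almost-all crux body at
  `e`**: a non-empty Zariski-open `W` of the parameter space `Spec ℂ[a]` and a MEAGRE `MS ⊆ W(ℂ)`, NULL IN EVERY ALGEBRAIC CHART, such that
  for every member `t ∉ MS` with `G_e(a(t)) ≠ 0`, every smooth projective `X` birational to the quartic plane of `a(t)` has `b₁(X) = 0` and
  satisfies the commutator clause `Comm` for every cohomological quaternion pair.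
* `K1Q_offNullMeagre_at_four_of_residues` — the `e = 4` case from (Z_b)₄, the registered LCERT₄ and Deligne 1987 — NO CDK, no Kollár,
  nothing at `e ≥ 6`.
* `K1Q_offNullMeagre_at_ge6_of_residues` — the even `e ≥ 6` cases from (Z_b) at `e`, the registered LCERT_{≥6} and Deligne 1987.

This is the currency of the UNCONDITIONAL leaves of routes A and B (`cyclicSurfacePowersHodge_ae`, `signThreefoldPowersHodge_ae`), one
coordinate push-forward short of a statement on `ℂ^{CIdx e}` (the coefficient chart `coeffs W` is an open embedding; left to a successor).
CONSEQUENCE FOR PLANNING: restated in almost-all form, the crux and the leaf `Q8SurfacePowersHodge` lose the print input CDK 1995 entirely;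
their inputs are (Z_b) [XL], LCERT₄ ∕ LCERT_{≥6} [XXL] and Deligne 1987 Prop. 1.13 [XL].

Honest scope: compositions, conditional on the displayed hypotheses; K1Q, its almost-all form, `Q8SurfacePowersHodge` and HC are NOT proved here.
-/

set_option linter.dupNamespace false
set_option maxHeartbeats 800000

noncomputable section

namespace Summit.HodgeConjecture.HodgeConjecture.Theorems.Q8SymplecticPowersK1QOffNullMeagre

open Summit.HodgeConjecture.HodgeConjecture.Theses.Q8SymplecticPowers (VeryGeneralQuaternionCommutatorsInHg)
open CategoryTheory CategoryTheory.Limits AlgebraicGeometry MonoidalCategory CartesianMonoidalCategory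
open Literature.AlgebraicGeometry Literature.AlgebraicGeometry.Motives Literature.AlgebraicGeometry.HodgeTheory
open Literature.AlgebraicGeometry.HodgeTheory.BettiUniverse Literature.AlgebraicGeometry.HodgeTheory.Q8Family
open Literature.AlgebraicGeometry.RelativeSpec Literature.AlgebraicGeometry.RelativeSpec.ActionOver

/-- **The almost-all crux body at `e`, CDK-free**: Deligne 1987 → (Z_b) at `e` → the S9-package at `e` → off a meagre chart-null set of
members of a non-empty Zariski-open `W`, `b₁(X) = 0` and `Comm` for every smooth model and every cohomological quaternion pair (module
docstring). [cite: Deligne1972WeilK3, Prop. 7.5] [cite: Andre1992, §4 Lemma 4] [cite: Deligne1987, Prop. 1.13] [cite: VoisinHodgeI2002, §9.1.1 Thm. 9.3] -/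
theorem K1Q_offNullMeagre_at
    (hdel : Literature.AlgebraicGeometry.HodgeTheory.deligne1987_monodromy_directSum_irreducible_subvariations) :
    open Literature.AlgebraicGeometry.Motives Literature.AlgebraicGeometry.HodgeTheory Literature.AlgebraicGeometry.HodgeTheory.BettiUniverse Literature.AlgebraicGeometry.HodgeTheory.Q8Family Literature.AlgebraicGeometry.RelativeSpec Literature.AlgebraicGeometry.RelativeSpec.ActionOver Literature.Algebra.Lie Literature.Algebra.Lie.KatzRecognition CategoryTheory CategoryTheory.Limits MonoidalCategory CartesianMonoidalCategory AlgebraicGeometry in let Uni : (X : SchemeOver ℂ) → IsSmoothProjective 2 X → (X ⟶ X) → (X ⟶ X) → (bettiCohomology X 2 ≃ₗ[ℚ] bettiCohomology X 2) → Prop := fun X hX τ j g => (∀ x, g (pull τ 2 x) = pull τ 2 (g x)) ∧ (∀ x, g (pull j 2 x) = pull j 2 (g x)) ∧ (∀ x y, tr hX (2 + 2) (cup X 2 2 (g x) (g y)) = tr hX (2 + 2) (cup X 2 2 x y)) ∧ ∀ x ∈ (hodge exists_isReal_hodgeModel_holds hX 2).hodgeClasses 1, g x = x; let Comm : (X : SchemeOver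 ℂ) → IsSmoothProjective 2 X → (X ⟶ X) → (X ⟶ X) → Prop := fun X hX τ j => haveI := finite hX 2; haveI : HodgeTensorFacts.{0, 0} := hodgeTensorFacts_holds; ∀ g h : bettiCohomology X 2 ≃ₗ[ℚ] bettiCohomology X 2, Uni X hX τ j g → Uni X hX τ j h → g * h * g⁻¹ * h⁻¹ ∈ (hodge exists_isReal_hodgeModel_holds hX 2).hodgeGroup; ∀ ⦃e : ℕ⦄, Even e → 4 ≤ e → (∀ g : ParamRing e, g ≠ 0 → ∃ a : CIdx e → ℂ, MvPolynomial.eval a g ≠ 0 ∧ MvPolynomial.eval a (genericityElem e) ≠ 0 ∧ ∃ (X₀ : SchemeOver ℂ) (_ : IsSmoothProjective 2 X₀), AlgebraicGeometry.Scheme.BirationalOver X₀.hom (fiberSch e (MvPolynomial.eval a)).hom ∧ Module.finrank ℚ (bettiCohomology X₀ 1) = 0) → (∃ (W : (Spec (.of (ParamRing e))).Opens) (𝒳 : SchemeOver ℂ) (π : 𝒳 ⟶ base W) (τ j : 𝒳 ⟶ 𝒳) (ι : (deckChart (fun i => (MvPolynomial.X i : ParamRing e)) ⊗ Over.mk W.ι).left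 ⟶ 𝒳.left), ∃ (_ : Nonempty (ComplexPoints (base W))) (hπ : IsSmoothProjectiveFamily π 2) (_ : IsQuasiProjectiveOver 𝒳) (_ : IsQuasiProjectiveOver (base W)) (_ : AlgebraicGeometry.SmoothOfRelativeDimension (Fintype.card (CIdx e)) (base W).hom) (hτπ : τ ≫ π = π) (hjπ : j ≫ π = π) (_ : τ ≫ τ ≫ τ ≫ τ = 𝟙 𝒳) (_ : j ≫ j = τ ≫ τ) (_ : τ ≫ j ≫ τ = j) (_ : IsOpenImmersion ι) (_ : ι ≫ π.left = (snd (deckChart (fun i => (MvPolynomial.X i : ParamRing e))) (Over.mk W.ι)).left) (_ : ((Over.isoMk ((deckAction (fun i => (MvPolynomial.X i : ParamRing e))).aut (QuaternionGroup.a 1)) ((deckAction (fun i => (MvPolynomial.X i : ParamRing e))).aut_comp (QuaternionGroup.a 1))).hom ▷ Over.mk W.ι).left ≫ ι = ι ≫ τ.left) (_ : ((Over.isoMk ((deckAction (fun i => (MvPolynomial.X i : ParamRing e))).aut (QuaternionGroup.xa 0)) ((deckAction (fun i => (MvPolynomial.X i : ParamRing e))).aut_comp (QuaternionGroup.xa 0))).hom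 ▷ Over.mk W.ι).left ≫ ι = ι ≫ j.left) (_ : Function.Surjective (snd (deckChart (fun i => (MvPolynomial.X i : ParamRing e))) (Over.mk W.ι)).left), ∀ (hU : IsCohomologicallyLocallyTrivialOn π Set.univ), (∀ s : ComplexPoints (base W), let Xs := fiberOver π s; let hXs : IsSmoothProjective 2 Xs := hπ.isSmoothProjective s; let A : bettiCohomology Xs 2 →ₗ[ℚ] bettiCohomology Xs 2 := pull (fiberOverEnd π τ hτπ s) 2; let Qf : LinearMap.BilinForm ℚ (bettiCohomology Xs 2) := LinearMap.compr₂ (cup Xs 2 2) (tr hXs (2 + 2)); let Γ := ratMonodromyGroup π 2 hU ⟨s, Set.mem_univ s⟩; let N : Submodule ℚ (bettiCohomology Xs 2) := Submodule.span ℚ {x | ∃ Γ' : Subgroup (bettiCohomology Xs 2 ≃ₗ[ℚ] bettiCohomology Xs 2), Γ' ≤ Γ ∧ (Γ'.subgroupOf Γ).FiniteIndex ∧ ∀ γ ∈ Γ', γ x = x}; let Mv : Submodule ℚ (bettiCohomology Xs 2) := Module.End.eigenspace (A ^ 2) (-1) ⊓ Qf.orthogonal N; let Miv : Submodule ℂ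 (TensorProduct ℚ ℂ (bettiCohomology Xs 2)) := Mv.baseChange ℂ ⊓ Module.End.eigenspace (A.baseChange ℂ) Complex.I; Module.finrank ℂ ↥(Module.End.eigenspace ((A ^ 2).baseChange ℂ) 1 ⊓ (hodge exists_isReal_hodgeModel_holds hXs 2).piece 2 0) = 0 ∧ 0 < Module.finrank ℂ ↥(Module.End.eigenspace ((A ^ 2).baseChange ℂ) (-1) ⊓ (hodge exists_isReal_hodgeModel_holds hXs 2).piece 2 0) ∧ (N.baseChange ℂ ⊓ (hodge exists_isReal_hodgeModel_holds hXs 2).piece 2 0 = ⊥) ∧ 6 ≤ Module.finrank ℂ Miv ∧ (∀ Γ' : Subgroup (bettiCohomology Xs 2 ≃ₗ[ℚ] bettiCohomology Xs 2), Γ' ≤ Γ → (Γ'.subgroupOf Γ).FiniteIndex → ∀ F : Submodule ℂ (TensorProduct ℚ ℂ (bettiCohomology Xs 2)), F ≤ Miv → (∀ γ ∈ Γ', ∀ x ∈ F, (γ.toLinearMap.baseChange ℂ) x ∈ F) → F = ⊥ ∨ F = Miv) ∧ N ≤ Module.End.eigenspace (A ^ 2) 1) ∧ (∀ s : ComplexPoints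 (base W), let Xs := fiberOver π s; let hXs : IsSmoothProjective 2 Xs := hπ.isSmoothProjective s; let A : bettiCohomology Xs 2 →ₗ[ℚ] bettiCohomology Xs 2 := pull (fiberOverEnd π τ hτπ s) 2; let B : bettiCohomology Xs 2 →ₗ[ℚ] bettiCohomology Xs 2 := pull (fiberOverEnd π j hjπ s) 2; let Qf : LinearMap.BilinForm ℚ (bettiCohomology Xs 2) := LinearMap.compr₂ (cup Xs 2 2) (tr hXs (2 + 2)); let Γ := ratMonodromyGroup π 2 hU ⟨s, Set.mem_univ s⟩; ∃ γ ∈ Γ, ∃ ℓp ℓm : TensorProduct ℚ ℂ (bettiCohomology Xs 2), ℓp ∈ (Module.End.eigenspace (A ^ 2) (-1)).baseChange ℂ ∧ ℓm ∈ (Module.End.eigenspace (A ^ 2) (-1)).baseChange ℂ ∧ A.baseChange ℂ ℓp = Complex.I • ℓp ∧ A.baseChange ℂ ℓm = Complex.I • ℓm ∧ (Qf.baseChange ℂ) ℓp (B.baseChange ℂ ℓm) ≠ 0 ∧ (γ.toLinearMap.baseChange ℂ) ℓp = Complex.I • ℓp ∧ (γ.toLinearMap.baseChange ℂ) ℓm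 = (-Complex.I) • ℓm ∧ ∀ x ∈ (Module.End.eigenspace (A ^ 2) (-1)).baseChange ℂ, A.baseChange ℂ x = Complex.I • x → (Qf.baseChange ℂ) x (B.baseChange ℂ ℓp) = 0 → (Qf.baseChange ℂ) x (B.baseChange ℂ ℓm) = 0 → (γ.toLinearMap.baseChange ℂ) x = x)) → ∃ (W : (Spec (.of (ParamRing e))).Opens) (hsm : AlgebraicGeometry.SmoothOfRelativeDimension (Fintype.card (CIdx e)) (base W).hom) (_ : Nonempty (ComplexPoints (base W))) (MS : Set (ComplexPoints (base W))), haveI := hsm; haveI : AlgebraicGeometry.Smooth (base W).hom := AlgebraicGeometry.SmoothOfRelativeDimension.smooth (Fintype.card (CIdx e)) _; haveI : AlgebraicGeometry.LocallyOfFiniteType (base W).hom := inferInstance; IsMeagre MS ∧ (∀ t₁ : ComplexPoints (base W), MeasureTheory.volume (ComplexPoints.algebraicChart (base W) (Fintype.card (CIdx e)) t₁ '' (MS ∩ (ComplexPoints.algebraicChart (base W) (Fintype.card (CIdx e)) t₁).source)) = 0) ∧ ∀ t : ComplexPoints (base W), t ∉ MS → MvPolynomial.eval (coeffs W t) (genericityElem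 e) ≠ 0 → ∀ ⦃V X : SchemeOver ℂ⦄ (hX : IsSmoothProjective 2 X), IsHypersurfaceCutOutBy 3 (quarticForm e (cOf (coeffs W t)) (ψOf (coeffs W t))) V → AlgebraicGeometry.Scheme.BirationalOver X.hom V.hom → Module.finrank ℚ (bettiCohomology X 1) = 0 ∧ ∀ τ j : X ⟶ X, (pull τ 2 ^ 4 = 1 ∧ pull j 2 ^ 2 = pull τ 2 ^ 2 ∧ pull j 2 * pull τ 2 = pull τ 2 ^ 3 * pull j 2 ∧ Module.finrank ℂ ↥(Module.End.eigenspace ((pull τ 2 ^ 2).baseChange ℂ) 1 ⊓ (hodge exists_isReal_hodgeModel_holds hX 2).piece 2 0) = 0 ∧ 0 < Module.finrank ℂ ↥(Module.End.eigenspace ((pull τ 2 ^ 2).baseChange ℂ) (-1) ⊓ (hodge exists_isReal_hodgeModel_holds hX 2).piece 2 0)) → Comm X hX τ j := by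
  intro Uni Comm e he h4 HZ hS9
  obtain ⟨W, 𝒳, π, τ, j, ι, hne, hπ, hqp, hqpW, hsm, hτπ, hjπ, hτ4, hj2, hτjτ, hιo, hιπ, hιτ, hιj, hsurj, h45⟩ := hS9
  obtain ⟨MS, hMS, hchart, hmain⟩ :=
    Q8SymplecticPowersTransportHeredityOffNullMeagre.transportHeredity_offNullMeagre_at @hdel
      Summit.HodgeConjecture.HodgeConjecture.Theorems.Q8SymplecticPowersAutFreeReduction.stub_autFreeReductionQ he h4
      W 𝒳 π τ j ι hne hπ hqp hqpW hsm hτπ hjπ hτ4 hj2 hτjτ hιo hιπ hιτ hιj hsurj h45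
  refine ⟨W, hsm, hne, MS, hMS, hchart, ?_⟩
  intro t ht hGe V X hX hV hbir
  refine ⟨?_, fun τ' j' hb' => hmain t ht hGe hX hV hbir τ' j' hb'⟩
  -- `b₁ = 0`: one Betti-regular member in the dense image of `W(ℂ)`, constancy of `b₁` along `π`, birational invariance
  have he2 : 2 ≤ e := le_trans (by norm_num) h4
  have he1 : 1 ≤ e := le_trans (by norm_num) h4
  haveI := hsm
  haveI : PathConnectedSpace (ComplexPoints (base W)) :=
    Q8SymplecticPowersRegularOfOneFibre.pathConnectedSpace_complexPoints_base (m := Fintype.card (CIdx e)) W hne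
  obtain ⟨S₀, hS₀⟩ := Q8SymplecticPowersGenericityPolynomials.exists_set_exists_point_iff W
  have hF₀ : ∃ F ∈ S₀, F ≠ 0 := by
    obtain ⟨t₁⟩ := hne
    have h := (hS₀ (coeffs W t₁)).1 ⟨t₁, rfl⟩
    by_contra h'
    push Not at h'
    exact h fun F hFS => by rw [h' F hFS, map_zero]
  obtain ⟨F, hFS, hF0⟩ := hF₀
  obtain ⟨a, hFa, hGa, X₀, hX₀, hbir₀, hq⟩ := HZ F hF0
  obtain ⟨t₀, ht₀⟩ : ∃ t' : ComplexPoints (base W), coeffs W t' = a :=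
    (hS₀ a).2 fun hall => hFa (hall F hFS)
  -- `X_{t₀} ~bir 𝒱_a ~bir X₀`
  have hcut := (Q8SymplecticPowersRegularOfDesingularization.exists_desingularization_fiberSch he2 a hGa).1
  rw [← ht₀] at hcut hGa
  have h0 : AlgebraicGeometry.Scheme.BirationalOver (fiberOver π t₀).hom (fiberSch e (MvPolynomial.eval (coeffs W t₀))).hom :=
    Q8SymplecticPowersFibreBirational.birationalOver_fiberOver_of_deckClauses he1 W 𝒳 π ι hπ hιo hιπ hsurj t₀ hGa hcut
  rw [ht₀] at h0
  -- `X ~bir V ~bir X_t`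
  have hbV := Q8SymplecticPowersFibreBirational.birationalOver_fiberOver_of_deckClauses he1 W 𝒳 π ι hπ hιo hιπ hsurj t hGe
    (V := V) hV
  rw [finrank_bettiCohomology_one_eq_of_birationalOver hX (hπ.isSmoothProjective t) (hbir.trans hbV.symm),
    finrank_bettiCohomology_fiberOver_eq_of_joined π hπ hqpW (d := Fintype.card (CIdx e)) (PathConnectedSpace.joined t t₀) 1,
    finrank_bettiCohomology_one_eq_of_birationalOver (hπ.isSmoothProjective t₀) hX₀ (h0.trans hbir₀.symm)]
  exact hq

/-- **The `e = 4` almost-all crux body — CDK-free, Kollár-free, nothing at `e ≥ 6`**: from (Z_b)₄, the registered member local certificate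
LCERT₄ (`stub_memberLocalCertificateQ4`, verbatim; it yields the S9-package at `e = 4` through p731940 → p733014 → p730189-minus-Kollár) and
Deligne 1987 Prop. 1.13. [cite: Deligne1972WeilK3, Prop. 7.5] [cite: Deligne1987, Prop. 1.13] -/
theorem K1Q_offNullMeagre_at_four_of_residues
    (HZ : ∀ g : ParamRing 4, g ≠ 0 → ∃ a : CIdx 4 → ℂ, MvPolynomial.eval a g ≠ 0 ∧ MvPolynomial.eval a (genericityElem 4) ≠ 0 ∧ ∃ (X₀ : SchemeOver ℂ) (_ : IsSmoothProjective 2 X₀), AlgebraicGeometry.Scheme.BirationalOver X₀.hom (fiberSch 4 (MvPolynomial.eval a)).hom ∧ Module.finrank ℚ (bettiCohomology X₀ 1) = 0)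
    (h₉₄ : open Literature.AlgebraicGeometry.Motives Literature.AlgebraicGeometry.HodgeTheory Literature.AlgebraicGeometry.HodgeTheory.BettiUniverse Literature.AlgebraicGeometry.HodgeTheory.Q8Family Literature.AlgebraicGeometry.RelativeSpec Literature.AlgebraicGeometry.RelativeSpec.ActionOver CategoryTheory CategoryTheory.Limits MonoidalCategory CartesianMonoidalCategory AlgebraicGeometry Literature.AlgebraicTopology.SingularHomology in ∀ ⦃e : ℕ⦄, e = 4 → ∃ (W : (Spec (.of (ParamRing e))).Opens) (𝒳 : SchemeOver ℂ) (π : 𝒳 ⟶ base W) (τ j : 𝒳 ⟶ 𝒳) (ι : (deckChart (fun i => (MvPolynomial.X i : ParamRing e)) ⊗ Over.mk W.ι).left ⟶ 𝒳.left), ∃ (_ : Nonempty (ComplexPoints (base W))) (hπ : IsSmoothProjectiveFamily π 2) (_ : IsQuasiProjectiveOver 𝒳) (_ : IsQuasiProjectiveOver (base W)) (_ : AlgebraicGeometry.SmoothOfRelativeDimension (Fintype.card (CIdx e)) (base W).hom) (hτπ : τ ≫ π = π) (hjπ : j ≫ π = π) (_ : τ ≫ τ ≫ τ ≫ τ = 𝟙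 𝒳) (_ : j ≫ j = τ ≫ τ) (_ : τ ≫ j ≫ τ = j) (_ : IsOpenImmersion ι) (_ : ι ≫ π.left = (snd (deckChart (fun i => (MvPolynomial.X i : ParamRing e))) (Over.mk W.ι)).left) (_ : ((Over.isoMk ((deckAction (fun i => (MvPolynomial.X i : ParamRing e))).aut (QuaternionGroup.a 1)) ((deckAction (fun i => (MvPolynomial.X i : ParamRing e))).aut_comp (QuaternionGroup.a 1))).hom ▷ Over.mk W.ι).left ≫ ι = ι ≫ τ.left) (_ : ((Over.isoMk ((deckAction (fun i => (MvPolynomial.X i : ParamRing e))).aut (QuaternionGroup.xa 0)) ((deckAction (fun i => (MvPolynomial.X i : ParamRing e))).aut_comp (QuaternionGroup.xa 0))).hom ▷ Over.mk W.ι).left ≫ ι = ι ≫ j.left) (_ : Function.Surjective (snd (deckChart (fun i => (MvPolynomial.X i : ParamRing e))) (Over.mk W.ι)).left), ∀ (hU : IsCohomologicallyLocallyTrivialOn π Set.univ), ∃ (b : ComplexPoints (base W)) (ψ : OpenPartialHomeomorph (Set.univ : Set (ComplexPoints (base W))) (Fin (Fintype.card (CIdx e)) → ℂ)) (W₀ :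 Set (Set.univ : Set (ComplexPoints (base W)))) (ω : (Fin (Fintype.card (CIdx e)) → ℂ) → TensorProduct ℚ ℂ (bettiCohomology (fiberOver π b) 2)) (r : ℕ), IsOpen W₀ ∧ (⟨b, Set.mem_univ b⟩ : (Set.univ : Set (ComplexPoints (base W)))) ∈ W₀ ∧ W₀ ⊆ ψ.source ∧ (let Xb := fiberOver π b; let hXb : IsSmoothProjective 2 Xb := hπ.isSmoothProjective b; let Ab : bettiCohomology Xb 2 →ₗ[ℚ] bettiCohomology Xb 2 := pull (fiberOverEnd π τ hτπ b) 2; let Mb : Submodule ℂ (TensorProduct ℚ ℂ (bettiCohomology Xb 2)) := Module.End.eigenspace (Ab.baseChange ℂ) Complex.I; Module.finrank ℂ ↥(Module.End.eigenspace ((Ab ^ 2).baseChange ℂ) 1 ⊓ (hodge exists_isReal_hodgeModel_holds hXb 2).piece 2 0) = 0 ∧ 0 < Module.finrank ℂ ↥(Module.End.eigenspace ((Ab ^ 2).baseChange ℂ) (-1) ⊓ (hodge exists_isReal_hodgeModel_holds hXb 2).piece 2 0) ∧ 6 ≤ Module.finrank ℂ ↥Mb ∧ Module.finrank ℂ ↥(Mb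 ⊓ (hodge exists_isReal_hodgeModel_holds hXb 2).F 2) ≤ 1 ∧ (∀ t ∈ W₀, ∀ (ε : Path (⟨b, Set.mem_univ b⟩ : (Set.univ : Set (ComplexPoints (base W)))) t), (∀ r', ε r' ∈ W₀) → ∀ (T : bettiCohomology Xb 2 ≃ₗ[ℚ] bettiCohomology (fiberOver π t.1) 2), (∀ v, ofRatClass _ 2 (T v) = transportFun π 2 hU ⟦ε⟧ (ofRatClass _ 2 v)) → ω (ψ t) ∈ Mb ⊓ ((hodge exists_isReal_hodgeModel_holds (hπ.isSmoothProjective t.1) 2).comapEquiv T).F 2) ∧ (∀ φ : Module.Dual ℂ (TensorProduct ℚ ℂ (bettiCohomology Xb 2)), (∀ i ≤ r, iteratedFDeriv ℂ i (fun z ↦ φ (ω z)) (ψ ⟨b, Set.mem_univ b⟩) = 0) → ∀ m ∈ Mb, φ m = 0)) ∧ ∃ (γ : bettiCohomology (fiberOver π b) 2 ≃ₗ[ℚ] bettiCohomology (fiberOver π b) 2), γ ∈ ratMonodromyGroup π 2 hU ⟨b, Set.mem_univ b⟩ ∧ (∃ a, pull (fiberOverEnd π τ hτπ b) 2 (pull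 (fiberOverEnd π τ hτπ b) 2 a) = -a ∧ γ a ≠ a) ∧ ∃ (h : ComplexPoints (fiberOver π b) ≃ₜ ComplexPoints (fiberOver π b)), (∀ a, γ a = (singularCohomology.map ℚ ℚ (h : C(ComplexPoints (fiberOver π b), ComplexPoints (fiberOver π b))) 2).hom a) ∧ singularHomology.map ℚ ℚ (h : C(ComplexPoints (fiberOver π b), ComplexPoints (fiberOver π b))) 4 (complexOrientationRat (hπ.isSmoothProjective b)).fundamentalClass = (complexOrientationRat (hπ.isSmoothProjective b)).fundamentalClass ∧ (∀ x, h ((AlgPoints.mapContinuous (L := ℂ) (fiberOverEnd π τ hτπ b)) x) = (AlgPoints.mapContinuous (L := ℂ) (fiberOverEnd π τ hτπ b)) (h x)) ∧ ∃ (A₁ A₂ B : Set (ComplexPoints (fiberOver π b))), IsOpen A₁ ∧ IsOpen A₂ ∧ IsOpen B ∧ A₁ ∪ A₂ ∪ B = Set.univ ∧ Disjoint (closure A₁) A₂ ∧ (∀ x ∈ B, h x = x) ∧ ∃ (hhA₁ : Set.MapsTo (h : C(ComplexPoints (fiberOver π b), ComplexPoints (fiberOver π b))) A₁ A₁) (hhA₂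 : Set.MapsTo (h : C(ComplexPoints (fiberOver π b), ComplexPoints (fiberOver π b))) A₂ A₂) (hτA₁ : Set.MapsTo (AlgPoints.mapContinuous (L := ℂ) (fiberOverEnd π τ hτπ b)) A₁ A₁) (hτA₂ : Set.MapsTo (AlgPoints.mapContinuous (L := ℂ) (fiberOverEnd π τ hτπ b)) A₂ A₂) (_ : Set.MapsTo (AlgPoints.mapContinuous (L := ℂ) (fiberOverEnd π j hjπ b)) A₁ A₂) (_ : Set.MapsTo (AlgPoints.mapContinuous (L := ℂ) (fiberOverEnd π j hjπ b)) A₂ A₁) (_ : Module.Finite ℚ (singularHomology ℚ ℚ (↥A₁) 2)) (_ : Module.Finite ℚ (singularHomology ℚ ℚ (↥A₂) 2)), Module.finrank ℚ ↥(Module.End.eigenspace ((singularHomology.map ℚ ℚ (singularHomology.restrictSelf (AlgPoints.mapContinuous (L := ℂ) (fiberOverEnd π τ hτπ b)) hτA₁) 2).hom ^ 2) (-1 : ℚ)) ≤ 2 ∧ (∀ a : singularHomology ℚ ℚ (↥A₁) 2, singularHomology.map ℚ ℚ (singularHomology.restrictSelf (AlgPoints.mapContinuous (L := ℂ) (fiberOverEnd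 π τ hτπ b)) hτA₁) 2 (singularHomology.map ℚ ℚ (singularHomology.restrictSelf (AlgPoints.mapContinuous (L := ℂ) (fiberOverEnd π τ hτπ b)) hτA₁) 2 a) = -a → singularHomology.map ℚ ℚ (singularHomology.restrictSelf (h : C(ComplexPoints (fiberOver π b), ComplexPoints (fiberOver π b))) hhA₁) 2 a = singularHomology.map ℚ ℚ (singularHomology.restrictSelf (AlgPoints.mapContinuous (L := ℂ) (fiberOverEnd π τ hτπ b)) hτA₁) 2 a) ∧ (∀ a : singularHomology ℚ ℚ (↥A₂) 2, singularHomology.map ℚ ℚ (singularHomology.restrictSelf (AlgPoints.mapContinuous (L := ℂ) (fiberOverEnd π τ hτπ b)) hτA₂) 2 (singularHomology.map ℚ ℚ (singularHomology.restrictSelf (AlgPoints.mapContinuous (L := ℂ) (fiberOverEnd π τ hτπ b)) hτA₂) 2 a) = -a → singularHomology.map ℚ ℚ (singularHomology.restrictSelf (h : C(ComplexPoints (fiberOver π b), ComplexPoints (fiberOver π b))) hhA₂) 2 (singularHomology.map ℚ ℚ (singularHomology.restrictSelf (AlgPoints.mapContinuous (L := ℂ) (fiberOverEnd π τ hτπ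 b)) hτA₂) 2 a) = a))
    (hdel : Literature.AlgebraicGeometry.HodgeTheory.deligne1987_monodromy_directSum_irreducible_subvariations) :
    open Literature.AlgebraicGeometry.Motives Literature.AlgebraicGeometry.HodgeTheory Literature.AlgebraicGeometry.HodgeTheory.BettiUniverse Literature.AlgebraicGeometry.HodgeTheory.Q8Family Literature.AlgebraicGeometry.RelativeSpec Literature.AlgebraicGeometry.RelativeSpec.ActionOver Literature.Algebra.Lie Literature.Algebra.Lie.KatzRecognition CategoryTheory CategoryTheory.Limits MonoidalCategory CartesianMonoidalCategory AlgebraicGeometry in let Uni : (X : SchemeOver ℂ) → IsSmoothProjective 2 X → (X ⟶ X) → (X ⟶ X) → (bettiCohomology X 2 ≃ₗ[ℚ] bettiCohomology X 2) → Prop := fun X hX τ j g => (∀ x, g (pull τ 2 x) = pull τ 2 (g x)) ∧ (∀ x, g (pull j 2 x) = pull j 2 (g x)) ∧ (∀ x y, tr hX (2 + 2) (cup X 2 2 (g x) (g y)) = tr hX (2 + 2) (cup X 2 2 x y)) ∧ ∀ x ∈ (hodge exists_isReal_hodgeModel_holds hX 2).hodgeClasses 1, g x = x; let Comm : (X : SchemeOver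 ℂ) → IsSmoothProjective 2 X → (X ⟶ X) → (X ⟶ X) → Prop := fun X hX τ j => haveI := finite hX 2; haveI : HodgeTensorFacts.{0, 0} := hodgeTensorFacts_holds; ∀ g h : bettiCohomology X 2 ≃ₗ[ℚ] bettiCohomology X 2, Uni X hX τ j g → Uni X hX τ j h → g * h * g⁻¹ * h⁻¹ ∈ (hodge exists_isReal_hodgeModel_holds hX 2).hodgeGroup; ∀ ⦃e : ℕ⦄, e = 4 → ∃ (W : (Spec (.of (ParamRing e))).Opens) (hsm : AlgebraicGeometry.SmoothOfRelativeDimension (Fintype.card (CIdx e)) (base W).hom) (_ : Nonempty (ComplexPoints (base W))) (MS : Set (ComplexPoints (base W))), haveI := hsm; haveI : AlgebraicGeometry.Smooth (base W).hom := AlgebraicGeometry.SmoothOfRelativeDimension.smooth (Fintype.card (CIdx e)) _; haveI : AlgebraicGeometry.LocallyOfFiniteType (base W).hom := inferInstance; IsMeagre MS ∧ (∀ t₁ : ComplexPoints (base W), MeasureTheory.volume (ComplexPoints.algebraicChart (base W) (Fintype.card (CIdx e)) t₁ '' (MS ∩ (ComplexPoints.algebraicChart (base W) (Fintype.card (CIdx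 e)) t₁).source)) = 0) ∧ ∀ t : ComplexPoints (base W), t ∉ MS → MvPolynomial.eval (coeffs W t) (genericityElem e) ≠ 0 → ∀ ⦃V X : SchemeOver ℂ⦄ (hX : IsSmoothProjective 2 X), IsHypersurfaceCutOutBy 3 (quarticForm e (cOf (coeffs W t)) (ψOf (coeffs W t))) V → AlgebraicGeometry.Scheme.BirationalOver X.hom V.hom → Module.finrank ℚ (bettiCohomology X 1) = 0 ∧ ∀ τ j : X ⟶ X, (pull τ 2 ^ 4 = 1 ∧ pull j 2 ^ 2 = pull τ 2 ^ 2 ∧ pull j 2 * pull τ 2 = pull τ 2 ^ 3 * pull j 2 ∧ Module.finrank ℂ ↥(Module.End.eigenspace ((pull τ 2 ^ 2).baseChange ℂ) 1 ⊓ (hodge exists_isReal_hodgeModel_holds hX 2).piece 2 0) = 0 ∧ 0 < Module.finrank ℂ ↥(Module.End.eigenspace ((pull τ 2 ^ 2).baseChange ℂ) (-1) ⊓ (hodge exists_isReal_hodgeModel_holds hX 2).piece 2 0)) → Comm X hX τ j := by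
  intro Uni Comm e he4
  have he : Even e := ⟨2, by omega⟩
  have h4 : 4 ≤ e := by omega
  have h₉ := Q8SymplecticPowersK1QOfStubsKollarFree.certifiedDeckFamilyQ4_of_member_kollarFree
    (Q8SymplecticPowersMemberDataOfCertificatesFactB.stub_memberDataQ4_of_jetSpan_clause hdel
      (Q8SymplecticPowersMemberCertificateOfKerDatum.stub_memberCertificateQ4_of_localConfiguration h₉₄)) he4
  subst he4
  exact K1Q_offNullMeagre_at @hdel he h4 HZ h₉

/-- **The even `e ≥ 6` almost-all crux bodies — CDK-free**: from (Z_b) at `e`, the registered LCERT_{≥6} and Deligne 1987.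
[cite: Deligne1972WeilK3, Prop. 7.5] [cite: Deligne1987, Prop. 1.13] -/
theorem K1Q_offNullMeagre_at_ge6_of_residues
    (HZ : ∀ ⦃e : ℕ⦄, Even e → 6 ≤ e → ∀ g : ParamRing e, g ≠ 0 → ∃ a : CIdx e → ℂ, MvPolynomial.eval a g ≠ 0 ∧ MvPolynomial.eval a (genericityElem e) ≠ 0 ∧ ∃ (X₀ : SchemeOver ℂ) (_ : IsSmoothProjective 2 X₀), AlgebraicGeometry.Scheme.BirationalOver X₀.hom (fiberSch e (MvPolynomial.eval a)).hom ∧ Module.finrank ℚ (bettiCohomology X₀ 1) = 0)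
    (h₉₆ : open Literature.AlgebraicGeometry.Motives Literature.AlgebraicGeometry.HodgeTheory Literature.AlgebraicGeometry.HodgeTheory.BettiUniverse Literature.AlgebraicGeometry.HodgeTheory.Q8Family Literature.AlgebraicGeometry.RelativeSpec Literature.AlgebraicGeometry.RelativeSpec.ActionOver CategoryTheory CategoryTheory.Limits MonoidalCategory CartesianMonoidalCategory AlgebraicGeometry Literature.AlgebraicTopology.SingularHomology in ∀ ⦃e : ℕ⦄, Even e → 6 ≤ e → ∃ (W : (Spec (.of (ParamRing e))).Opens) (𝒳 : SchemeOver ℂ) (π : 𝒳 ⟶ base W) (τ j : 𝒳 ⟶ 𝒳) (ι : (deckChart (fun i => (MvPolynomial.X i : ParamRing e)) ⊗ Over.mk W.ι).left ⟶ 𝒳.left), ∃ (_ : Nonempty (ComplexPoints (base W))) (hπ : IsSmoothProjectiveFamily π 2) (_ : IsQuasiProjectiveOver 𝒳) (_ : IsQuasiProjectiveOver (base W)) (_ : AlgebraicGeometry.SmoothOfRelativeDimension (Fintype.card (CIdx e)) (base W).hom) (hτπ : τ ≫ π = π) (hjπ : j ≫ π = π) (_ : τ ≫ τ ≫ τ ≫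 τ = 𝟙 𝒳) (_ : j ≫ j = τ ≫ τ) (_ : τ ≫ j ≫ τ = j) (_ : IsOpenImmersion ι) (_ : ι ≫ π.left = (snd (deckChart (fun i => (MvPolynomial.X i : ParamRing e))) (Over.mk W.ι)).left) (_ : ((Over.isoMk ((deckAction (fun i => (MvPolynomial.X i : ParamRing e))).aut (QuaternionGroup.a 1)) ((deckAction (fun i => (MvPolynomial.X i : ParamRing e))).aut_comp (QuaternionGroup.a 1))).hom ▷ Over.mk W.ι).left ≫ ι = ι ≫ τ.left) (_ : ((Over.isoMk ((deckAction (fun i => (MvPolynomial.X i : ParamRing e))).aut (QuaternionGroup.xa 0)) ((deckAction (fun i => (MvPolynomial.X i : ParamRing e))).aut_comp (QuaternionGroup.xa 0))).hom ▷ Over.mk W.ι).left ≫ ι = ι ≫ j.left) (_ : Function.Surjective (snd (deckChart (fun i => (MvPolynomial.X i : ParamRing e))) (Over.mk W.ι)).left), ∀ (hU : IsCohomologicallyLocallyTrivialOn π Set.univ), ∃ (b : ComplexPoints (base W)) (ψ : OpenPartialHomeomorph (Set.univ : Set (ComplexPoints (base W))) (Fin (Fintype.card (CIdx e)) → ℂ))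 (W₀ : Set (Set.univ : Set (ComplexPoints (base W)))) (ι₁ ι₂ : Type) (ω : (Fin (Fintype.card (CIdx e)) → ℂ) → ι₁ → TensorProduct ℚ ℂ (bettiCohomology (fiberOver π b) 2)) (η : (Fin (Fintype.card (CIdx e)) → ℂ) → ι₂ → Module.Dual ℂ (TensorProduct ℚ ℂ (bettiCohomology (fiberOver π b) 2))) (r : ℕ), IsOpen W₀ ∧ (⟨b, Set.mem_univ b⟩ : (Set.univ : Set (ComplexPoints (base W)))) ∈ W₀ ∧ W₀ ⊆ ψ.source ∧ (let Xb := fiberOver π b; let hXb : IsSmoothProjective 2 Xb := hπ.isSmoothProjective b; let Ab : bettiCohomology Xb 2 →ₗ[ℚ] bettiCohomology Xb 2 := pull (fiberOverEnd π τ hτπ b) 2; let Mb : Submodule ℂ (TensorProduct ℚ ℂ (bettiCohomology Xb 2)) := Module.End.eigenspace (Ab.baseChange ℂ) Complex.I; Module.finrank ℂ ↥(Module.End.eigenspace ((Ab ^ 2).baseChange ℂ) 1 ⊓ (hodge exists_isReal_hodgeModel_holds hXb 2).piece 2 0) = 0 ∧ 0 < Module.finrank ℂ ↥(Module.End.eigenspace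 ((Ab ^ 2).baseChange ℂ) (-1) ⊓ (hodge exists_isReal_hodgeModel_holds hXb 2).piece 2 0) ∧ 6 ≤ Module.finrank ℂ ↥Mb ∧ (∀ t ∈ W₀, ∀ (ε : Path (⟨b, Set.mem_univ b⟩ : (Set.univ : Set (ComplexPoints (base W)))) t), (∀ r', ε r' ∈ W₀) → ∀ (T : bettiCohomology Xb 2 ≃ₗ[ℚ] bettiCohomology (fiberOver π t.1) 2), (∀ v, ofRatClass _ 2 (T v) = transportFun π 2 hU ⟦ε⟧ (ofRatClass _ 2 v)) → ∀ i, ω (ψ t) i ∈ Mb ⊓ ((hodge exists_isReal_hodgeModel_holds (hπ.isSmoothProjective t.1) 2).comapEquiv T).F 2) ∧ (∀ t ∈ W₀, ∀ (ε : Path (⟨b, Set.mem_univ b⟩ : (Set.univ : Set (ComplexPoints (base W)))) t), (∀ r', ε r' ∈ W₀) → ∀ (T : bettiCohomology Xb 2 ≃ₗ[ℚ] bettiCohomology (fiberOver π t.1) 2), (∀ v, ofRatClass _ 2 (T v) = transportFun π 2 hU ⟦ε⟧ (ofRatClass _ 2 v)) → ∀ l, ∀ x ∈ Mb ⊓ ((hodge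 exists_isReal_hodgeModel_holds (hπ.isSmoothProjective t.1) 2).comapEquiv T).F 2, η (ψ t) l x = 0) ∧ (∀ φ : (TensorProduct ℚ ℂ (bettiCohomology Xb 2)) →ₗ[ℂ] (TensorProduct ℚ ℂ (bettiCohomology Xb 2)), (∀ x ∈ Mb, φ x ∈ Mb) → (∀ i l, ∀ m ≤ r, iteratedFDeriv ℂ m (fun z ↦ η z l (φ (ω z i))) (ψ ⟨b, Set.mem_univ b⟩) = 0) → ∃ c : ℂ, ∀ x ∈ Mb, φ x = c • x)) ∧ ∃ (γ : bettiCohomology (fiberOver π b) 2 ≃ₗ[ℚ] bettiCohomology (fiberOver π b) 2), γ ∈ ratMonodromyGroup π 2 hU ⟨b, Set.mem_univ b⟩ ∧ (∃ a, pull (fiberOverEnd π τ hτπ b) 2 (pull (fiberOverEnd π τ hτπ b) 2 a) = -a ∧ γ a ≠ a) ∧ ∃ (h : ComplexPoints (fiberOver π b) ≃ₜ ComplexPoints (fiberOver π b)), (∀ a, γ a = (singularCohomology.map ℚ ℚ (h : C(ComplexPoints (fiberOver π b), ComplexPoints (fiberOver π b))) 2).hom a) ∧ singularHomology.map ℚ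 ℚ (h : C(ComplexPoints (fiberOver π b), ComplexPoints (fiberOver π b))) 4 (complexOrientationRat (hπ.isSmoothProjective b)).fundamentalClass = (complexOrientationRat (hπ.isSmoothProjective b)).fundamentalClass ∧ (∀ x, h ((AlgPoints.mapContinuous (L := ℂ) (fiberOverEnd π τ hτπ b)) x) = (AlgPoints.mapContinuous (L := ℂ) (fiberOverEnd π τ hτπ b)) (h x)) ∧ ∃ (A₁ A₂ B : Set (ComplexPoints (fiberOver π b))), IsOpen A₁ ∧ IsOpen A₂ ∧ IsOpen B ∧ A₁ ∪ A₂ ∪ B = Set.univ ∧ Disjoint (closure A₁) A₂ ∧ (∀ x ∈ B, h x = x) ∧ ∃ (hhA₁ : Set.MapsTo (h : C(ComplexPoints (fiberOver π b), ComplexPoints (fiberOver π b))) A₁ A₁) (hhA₂ : Set.MapsTo (h : C(ComplexPoints (fiberOver π b), ComplexPoints (fiberOver π b))) A₂ A₂) (hτA₁ : Set.MapsTo (AlgPoints.mapContinuous (L := ℂ) (fiberOverEnd π τ hτπ b)) A₁ A₁) (hτA₂ : Set.MapsTo (AlgPoints.mapContinuous (L := ℂ) (fiberOverEnd π τ hτπ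 b)) A₂ A₂) (_ : Set.MapsTo (AlgPoints.mapContinuous (L := ℂ) (fiberOverEnd π j hjπ b)) A₁ A₂) (_ : Set.MapsTo (AlgPoints.mapContinuous (L := ℂ) (fiberOverEnd π j hjπ b)) A₂ A₁) (_ : Module.Finite ℚ (singularHomology ℚ ℚ (↥A₁) 2)) (_ : Module.Finite ℚ (singularHomology ℚ ℚ (↥A₂) 2)), Module.finrank ℚ ↥(Module.End.eigenspace ((singularHomology.map ℚ ℚ (singularHomology.restrictSelf (AlgPoints.mapContinuous (L := ℂ) (fiberOverEnd π τ hτπ b)) hτA₁) 2).hom ^ 2) (-1 : ℚ)) ≤ 2 ∧ (∀ a : singularHomology ℚ ℚ (↥A₁) 2, singularHomology.map ℚ ℚ (singularHomology.restrictSelf (AlgPoints.mapContinuous (L := ℂ) (fiberOverEnd π τ hτπ b)) hτA₁) 2 (singularHomology.map ℚ ℚ (singularHomology.restrictSelf (AlgPoints.mapContinuous (L := ℂ) (fiberOverEnd π τ hτπ b)) hτA₁) 2 a) = -a → singularHomology.map ℚ ℚ (singularHomology.restrictSelf (h : C(ComplexPoints (fiberOver π b), ComplexPoints (fiberOver π b)))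 hhA₁) 2 a = singularHomology.map ℚ ℚ (singularHomology.restrictSelf (AlgPoints.mapContinuous (L := ℂ) (fiberOverEnd π τ hτπ b)) hτA₁) 2 a) ∧ (∀ a : singularHomology ℚ ℚ (↥A₂) 2, singularHomology.map ℚ ℚ (singularHomology.restrictSelf (AlgPoints.mapContinuous (L := ℂ) (fiberOverEnd π τ hτπ b)) hτA₂) 2 (singularHomology.map ℚ ℚ (singularHomology.restrictSelf (AlgPoints.mapContinuous (L := ℂ) (fiberOverEnd π τ hτπ b)) hτA₂) 2 a) = -a → singularHomology.map ℚ ℚ (singularHomology.restrictSelf (h : C(ComplexPoints (fiberOver π b), ComplexPoints (fiberOver π b))) hhA₂) 2 (singularHomology.map ℚ ℚ (singularHomology.restrictSelf (AlgPoints.mapContinuous (L := ℂ) (fiberOverEnd π τ hτπ b)) hτA₂) 2 a) = a))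
    (hdel : Literature.AlgebraicGeometry.HodgeTheory.deligne1987_monodromy_directSum_irreducible_subvariations) :
    open Literature.AlgebraicGeometry.Motives Literature.AlgebraicGeometry.HodgeTheory Literature.AlgebraicGeometry.HodgeTheory.BettiUniverse Literature.AlgebraicGeometry.HodgeTheory.Q8Family Literature.AlgebraicGeometry.RelativeSpec Literature.AlgebraicGeometry.RelativeSpec.ActionOver Literature.Algebra.Lie Literature.Algebra.Lie.KatzRecognition CategoryTheory CategoryTheory.Limits MonoidalCategory CartesianMonoidalCategory AlgebraicGeometry in let Uni : (X : SchemeOver ℂ) → IsSmoothProjective 2 X → (X ⟶ X) → (X ⟶ X) → (bettiCohomology X 2 ≃ₗ[ℚ] bettiCohomology X 2) → Prop := fun X hX τ j g => (∀ x, g (pull τ 2 x) = pull τ 2 (g x)) ∧ (∀ x, g (pull j 2 x) = pull j 2 (g x)) ∧ (∀ x y, tr hX (2 + 2) (cup X 2 2 (g x) (g y)) = tr hX (2 + 2) (cup X 2 2 x y)) ∧ ∀ x ∈ (hodge exists_isReal_hodgeModel_holds hX 2).hodgeClasses 1, g x = x; let Comm : (X : SchemeOver ℂ) → IsSmoothProjective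 2 X → (X ⟶ X) → (X ⟶ X) → Prop := fun X hX τ j => haveI := finite hX 2; haveI : HodgeTensorFacts.{0, 0} := hodgeTensorFacts_holds; ∀ g h : bettiCohomology X 2 ≃ₗ[ℚ] bettiCohomology X 2, Uni X hX τ j g → Uni X hX τ j h → g * h * g⁻¹ * h⁻¹ ∈ (hodge exists_isReal_hodgeModel_holds hX 2).hodgeGroup; ∀ ⦃e : ℕ⦄, Even e → 6 ≤ e → ∃ (W : (Spec (.of (ParamRing e))).Opens) (hsm : AlgebraicGeometry.SmoothOfRelativeDimension (Fintype.card (CIdx e)) (base W).hom) (_ : Nonempty (ComplexPoints (base W))) (MS : Set (ComplexPoints (base W))), haveI := hsm; haveI : AlgebraicGeometry.Smooth (base W).hom := AlgebraicGeometry.SmoothOfRelativeDimension.smooth (Fintype.card (CIdx e)) _; haveI : AlgebraicGeometry.LocallyOfFiniteType (base W).hom := inferInstance; IsMeagre MS ∧ (∀ t₁ : ComplexPoints (base W), MeasureTheory.volume (ComplexPoints.algebraicChart (base W) (Fintype.card (CIdx e)) t₁ '' (MS ∩ (ComplexPoints.algebraicChart (base W) (Fintype.card (CIdx e)) t₁).source))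 = 0) ∧ ∀ t : ComplexPoints (base W), t ∉ MS → MvPolynomial.eval (coeffs W t) (genericityElem e) ≠ 0 → ∀ ⦃V X : SchemeOver ℂ⦄ (hX : IsSmoothProjective 2 X), IsHypersurfaceCutOutBy 3 (quarticForm e (cOf (coeffs W t)) (ψOf (coeffs W t))) V → AlgebraicGeometry.Scheme.BirationalOver X.hom V.hom → Module.finrank ℚ (bettiCohomology X 1) = 0 ∧ ∀ τ j : X ⟶ X, (pull τ 2 ^ 4 = 1 ∧ pull j 2 ^ 2 = pull τ 2 ^ 2 ∧ pull j 2 * pull τ 2 = pull τ 2 ^ 3 * pull j 2 ∧ Module.finrank ℂ ↥(Module.End.eigenspace ((pull τ 2 ^ 2).baseChange ℂ) 1 ⊓ (hodge exists_isReal_hodgeModel_holds hX 2).piece 2 0) = 0 ∧ 0 < Module.finrank ℂ ↥(Module.End.eigenspace ((pull τ 2 ^ 2).baseChange ℂ) (-1) ⊓ (hodge exists_isReal_hodgeModel_holds hX 2).piece 2 0)) → Comm X hX τ j := by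
  intro Uni Comm e he h6
  have h4 : 4 ≤ e := by omega
  have h₉ := Q8SymplecticPowersK1QOfStubsKollarFree.certifiedDeckFamilyQge6_of_member_kollarFree
    (Q8SymplecticPowersMemberDataOfCertificatesFactB.stub_memberDataQge6_of_jetStabilizer_clause hdel
      (Q8SymplecticPowersMemberCertificateOfKerDatum.stub_memberCertificateQge6_of_localConfiguration h₉₆)) he h6
  exact K1Q_offNullMeagre_at @hdel he h4 (HZ he h6) h₉

end Summit.HodgeConjecture.HodgeConjecture.Theorems.Q8SymplecticPowersK1QOffNullMeagre

end
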